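import Summits.BirchSwinnertonDyer.BirchSwinnertonDyer.Theorems.PrintCFramBottomClassIndexLawFiveLeHeegnerFieldSupplySeedTwist
import Summits.BirchSwinnertonDyer.BirchSwinnertonDyer.Theorems.PrintCFramBottomClassIndexLawFiveLeOffLocusDictionary
import HarnessLib

/-!
# Crux `PrintCFram.BottomClassIndexLawFiveLe` (stmt-BirchSwinnertonDyer-20372), line `eisenstein-resource-bdp-line` (registry v21):
# THE RAMIFIED TWIST SEED, CONVERSE — on the `p`-RAMIFIED side registry v21's `stub_seedOff` and (TwistReg⁶) are the SAME statement
# (cell `bsd-print-cfram`, width seat `bsd-line-cfram-p1-w3` g11; THEOREMS ONLY, `--supports` 20372; BSD is not proved by any of this)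

HONEST FRAMING. Nothing here is a statement about BSD; no stub is closed; `(SeedII⁶)` (= `stub_seedOff`) is neither proved nor refuted.
The companion file `…HeegnerFieldSupplySeedTwist` (this seat) proved `(SeedII⁶) ⟸ (TwistReg⁶)`: a regular `p`-RAMIFIED real-twist
partner `(s, χ' = χ·J(· | s))` of the class datum `(p, m, χ, k)` yields the `(Seed⁶)` witness `K₀ = ℚ(√−ps)` (w8 g5's
`seed_six_of_regularPartner`, p683327, is the same pointwise statement with the product character `χ↑χ_s↑`). This file proves the
CONVERSE on the ramified side:

* `kroneckerCharacter_apply_eq_jacobiSym_of_odd` — the Kronecker character `ε₀` of an imaginary quadratic field with ODD discriminant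
  `d` has the values `J(a | |d|)` at EVERY `a ∈ ℕ` (uniqueness of the Kronecker character, w3 g7's
  `OffLocusDictionary.eq_of_isKroneckerCharacterOf`, against the `J`-valued one of `KrizLiBinders.exists_isKroneckerCharacterOf_of_discr`);
* `norm_fieldFactor_le_inv_iff_twistClassFactor` — for `d_{K₀} = −ps` (`s ≡ 1 (mod 4)`, `s ⊥ pm`): the field factor of `(SeedII⁶)` at
  `K₀` is a non-unit IFF the twisted class factor is: `‖k⁻¹ B_{k,(χ↑ε₀↑)~}‖ ≤ p⁻¹ ⟺ ‖(p−k)⁻¹ B_{p−k,χ'}‖ ≤ p⁻¹`;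
* `twistRegular_of_ramifiedSeed` — every `p`-RAMIFIED witness of `(SeedII⁶)` (`K₀` imaginary quadratic, `d_{K₀}` odd, `p ∣ d_{K₀}`,
  every `q ∣ m` split, unit field factor) IS a regular twist partner `(s = |d_{K₀}|/p, χ')` satisfying every clause of (TwistReg⁶);
* `jacobiSym_neg_mul_eq_one_iff` — the split clause `J(−ps | q) = 1` is the progression condition `J(s | q) = J(−p | q)` (`q ∤ ps`).

READING for the planner / LEAD's dossier: (TwistReg⁶) is not merely «a documented sufficient route» to `stub_seedOff` — it is
`stub_seedOff` RESTRICTED TO `p`-RAMIFIED WITNESSES, verbatim up to this kernel equivalence; what it gives up are exactly the `p`-inert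
and `p`-split seeds (whose field factors are Kriz–Li second factors of the class at unramified fields, registry v19 currency). So the
analytic residue of the line reads, in ONE currency (generalized Bernoulli numbers `B_{p−k,χ'}` of quadratic characters of conductor
prime to `p` — the numbers whose non-units define B1's locus): «some member of the `ℚ(√−ps)`-split real-twist progression of the class
is Eisenstein-regular» ∨ «an unramified admissible field has a unit field factor». beyond-print theorem: NO.

References: [Cox2013] §1.C Lemma 1.14, (1.18); [Marcus2018] Ch. 2 Thm. 1, Ch. 3 Thm. 25; [Washington1997] Thm. 5.11, Cor. 5.13, §5.1;
[IrelandRosen1990] Prop. 5.1.2; [KrizLi2019] §2 (ε_K), Thm. 1.20, §8.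
-/

set_option autoImplicit false
-- summit-side namespace `Summit.BirchSwinnertonDyer.BirchSwinnertonDyer.…` (single-conjunct summit, D-0017 layout)
set_option linter.dupNamespace false

noncomputable section

open scoped Classical NumberTheorySymbols
open NumberField WeierstrassCurve DirichletCharacter Literature.NumberTheory.LFunctions
  Literature.NumberTheory.EllipticCurves Literature.NumberTheory.EllipticCurves.KrizLi2019
  Literature.NumberTheory.EllipticCurves.Rank1Residual Literature.NumberTheory.Congruences
  Literature.NumberTheory.QuadraticFields

namespace Summit.BirchSwinnertonDyer.BirchSwinnertonDyer.Theorems.PrintCFram.HeegnerFieldSupply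

open Summit.BirchSwinnertonDyer.BirchSwinnertonDyer.Theorems.PrintCFram
open Summit.BirchSwinnertonDyer.BirchSwinnertonDyer.Theorems.PrintCFram.KummerDictionary
open Summit.BirchSwinnertonDyer.Rank1Residual Summit.BirchSwinnertonDyer.Rank1Residual.X12.O11

variable {p : ℕ} [hp : Fact p.Prime]

/-! ## §1 The Kronecker character of an odd-discriminant field, at every natural number -/

/-- **The Kronecker character of an imaginary quadratic field with ODD discriminant `d` has the values `J(a | |d|)` at EVERY
`a ∈ ℕ`** (not only at the primes `ℓ ∤ d` where `IsKroneckerCharacterOf` pins it): the `J(· | |d|)`-valued character of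
`KrizLiBinders.exists_isKroneckerCharacterOf_of_discr` (`d = −|d|`, `|d| ≡ 3 (mod 4)` squarefree — `d` is a fundamental
discriminant, `Quadratic.isFundamentalDiscriminant_discr`) is a Kronecker character of the field, and a Kronecker character is
unique (`OffLocusDictionary.eq_of_isKroneckerCharacterOf`, Dirichlet's theorem on primes in progressions).
[cite: Cox2013, §1.C Lemma 1.14 and (1.18)] [cite: KrizLi2019, §2 (p. 12, ε_K)] [cite: Marcus2018, Ch. 2 Thm. 1] -/
theorem kroneckerCharacter_apply_eq_jacobiSym_of_odd {K₀ : Type} [Field K₀] [NumberField K₀] (hK₀ : IsImaginaryQuadratic K₀)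
    (hodd : Odd (NumberField.discr K₀)) {ε₀ : DirichletCharacter ℚ_[p] (NumberField.discr K₀).natAbs}
    (hε₀ : IsKroneckerCharacterOf K₀ ε₀) (a : ℕ) :
    ε₀ (a : ZMod (NumberField.discr K₀).natAbs) = (J((a : ℤ) | (NumberField.discr K₀).natAbs) : ℚ_[p]) := by
  have h2 := hK₀.1
  have hneg : NumberField.discr K₀ < 0 := IsImaginaryQuadratic.discr_neg hK₀
  have hd : NumberField.discr K₀ = -((NumberField.discr K₀).natAbs : ℤ) := by
    rw [Int.ofNat_natAbs_of_nonpos hneg.le, neg_neg]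
  rcases Quadratic.isFundamentalDiscriminant_discr (K := K₀) h2 with ⟨h1, hsf, -⟩ | ⟨h4, -, -⟩
  · have hn3 : (NumberField.discr K₀).natAbs % 4 = 3 := by omega
    have hsq : Squarefree (NumberField.discr K₀).natAbs := Int.squarefree_natAbs.mpr hsf
    obtain ⟨ε₁, hε₁, hε₁v⟩ := KrizLiBinders.exists_isKroneckerCharacterOf_of_discr (p := p) h2
      (m := (NumberField.discr K₀).natAbs) hsq (Or.inr ⟨hd, hn3⟩)
    rw [OffLocusDictionary.eq_of_isKroneckerCharacterOf hε₀ hε₁, hε₁v a]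
  · exfalso
    rw [Int.odd_iff] at hodd
    omega

/-! ## §2 Field factor at `ℚ(√−ps)` ⟷ twisted class factor -/

/-- **Field factor at `ℚ(√−ps)` ⟷ twisted class factor.** For `p ≡ 3 (mod 4)`, `p ≥ 7`, `χ` primitive mod `m ⊥ p`,
`k ∈ {(p+1)/4, (3p−1)/4}`, `s ≡ 1 (mod 4)` with `s ⊥ pm`, an imaginary quadratic `K₀` with `d_{K₀} = −ps` and Kronecker character `ε₀`, and `χ'` mod `m·s`
with the values `χ(a)·J(a | s)`: `‖k⁻¹ B_{k,(χ↑ε₀↑)~}‖ ≤ p⁻¹ ⟺ ‖(p−k)⁻¹ B_{p−k,χ'}‖ ≤ p⁻¹` — the field factor of `(SeedII⁶)` at a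
`p`-RAMIFIED field is a non-unit iff the class factor of the real-twist partner is. (The values of `ε₀` are `J(a | ps) = J(a|p)J(a|s)`
by `kroneckerCharacter_apply_eq_jacobiSym_of_odd`; then the transport of `seed_of_ramifiedTwist` and w8 g5's CM reflection at `χ'`.)
[cite: Washington1997, Thm. 5.11 and Cor. 5.13] [cite: Cox2013, §1.C Lemma 1.14] [cite: IrelandRosen1990, Prop. 5.1.2] -/
theorem norm_fieldFactor_le_inv_iff_twistClassFactor (hp3 : p % 4 = 3) (h7 : 7 ≤ p) {m : ℕ} [NeZero m] (hmp : m.Coprime p)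
    (χ : DirichletCharacter ℚ_[p] m) (hχ : χ.IsPrimitive) {k : ℕ} (hk : k = (p + 1) / 4 ∨ k = (3 * p - 1) / 4)
    {s : ℕ} [NeZero s] (hs4 : s % 4 = 1) (hsp : s.Coprime p) (hms : m.Coprime s)
    {K₀ : Type} [Field K₀] [NumberField K₀] (hK₀ : IsImaginaryQuadratic K₀)
    (hd : NumberField.discr K₀ = -((p * s : ℕ) : ℤ))
    {ε₀ : DirichletCharacter ℚ_[p] (NumberField.discr K₀).natAbs} (hε₀ : IsKroneckerCharacterOf K₀ ε₀)
    (χ' : DirichletCharacter ℚ_[p] (m * s))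
    (hχ' : ∀ a : ℕ, χ' (a : ZMod (m * s)) = χ (a : ZMod m) * (J((a : ℤ) | s) : ℚ_[p])) :
    ‖(k : ℚ_[p])⁻¹ * @generalizedBernoulli ℚ_[p] _ _
        (changeLevel (dvd_mul_right m (NumberField.discr K₀).natAbs) χ *
          changeLevel (dvd_mul_left (NumberField.discr K₀).natAbs m) ε₀).conductor ⟨conductor_ne_zero _⟩ k
        (changeLevel (dvd_mul_right m (NumberField.discr K₀).natAbs) χ *
          changeLevel (dvd_mul_left (NumberField.discr K₀).natAbs m) ε₀).primitiveCharacter‖ ≤ (p : ℝ)⁻¹ ↔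
      ‖((p - k : ℕ) : ℚ_[p])⁻¹ * generalizedBernoulli (p - k) χ'‖ ≤ (p : ℝ)⁻¹ := by
  have hpp := hp.out
  have hp2 : p ≠ 2 := by omega
  have hmps : m.Coprime (p * s) := Nat.Coprime.mul_right hmp hms
  have hmsp : (m * s).Coprime p := Nat.Coprime.mul_left hmp hsp
  have hdn : (NumberField.discr K₀).natAbs = p * s := by rw [hd, Int.natAbs_neg, Int.natAbs_natCast]
  have hps3 : (p * s) % 4 = 3 := by
    rw [Nat.mul_mod, hp3, hs4]
  have hodd : Odd (NumberField.discr K₀) := by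
    rw [hd, Int.odd_iff]
    omega
  have hε₀v : ∀ a : ℕ, ε₀ (a : ZMod (NumberField.discr K₀).natAbs) = (J((a : ℤ) | p * s) : ℚ_[p]) := by
    intro a
    rw [kroneckerCharacter_apply_eq_jacobiSym_of_odd hK₀ hodd hε₀ a, hdn]
  obtain ⟨ω, hω⟩ := exists_isTeichmullerCharacter (p := p)
  have hh : (p - 1) / 2 ≠ 0 := by omega
  set Ψ : DirichletCharacter ℚ_[p] (m * (NumberField.discr K₀).natAbs) :=
    changeLevel (dvd_mul_right m (NumberField.discr K₀).natAbs) χ *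
      changeLevel (dvd_mul_left (NumberField.discr K₀).natAbs m) ε₀ with hΨ
  have hcχ : χ.conductor = m := hχ
  have hcε : ε₀.conductor = (NumberField.discr K₀).natAbs := hε₀.1
  have hcond : Ψ.conductor = m * s * p := by
    rw [hΨ, RouteU.conductor_changeLevel_mul_changeLevel _ _ χ ε₀ (by rw [hcχ, hcε, hdn]; exact hmps),
      hcχ, hcε, hdn]
    ring
  have hΨprim : Ψ.IsPrimitive := by
    rw [isPrimitive_def, hcond, hdn]
    ring
  have hval : ∀ a : ℕ, Ψ.primitiveCharacter (a : ZMod Ψ.conductor) =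
      (changeLevel (dvd_mul_right (m * s) p) χ' * changeLevel (dvd_mul_left p (m * s)) (ω ^ ((p - 1) / 2)) :
        DirichletCharacter ℚ_[p] (m * s * p)) (a : ZMod (m * s * p)) := by
    intro a
    rw [primitiveCharacter_apply_natCast_of_isPrimitive Ψ hΨprim a, hΨ,
      CharacterTwist.changeLevel_mul_changeLevel_apply_natCast χ ε₀ a, thetaShape_apply_natCast χ' ω hh a,
      hε₀v a, hχ' a, ← jacobiSym_eq_teichmuller_pow_half hω hp2 a, jacobiSym.mul_right, Int.cast_mul]
    ring
  have hB : @generalizedBernoulli ℚ_[p] _ _ Ψ.conductor ⟨conductor_ne_zero _⟩ k Ψ.primitiveCharacter =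
      generalizedBernoulli k (changeLevel (dvd_mul_right (m * s) p) χ' *
        changeLevel (dvd_mul_left p (m * s)) (ω ^ ((p - 1) / 2))) := by
    haveI : NeZero Ψ.conductor := ⟨conductor_ne_zero _⟩
    exact generalizedBernoulli_eq_of_forall_apply_natCast_eq hcond _ _ hval k
  rw [hB]
  exact norm_div_generalizedBernoulli_legendreTwist_le_inv_iff hp3 h7 hmsp χ' hω hk

/-! ## §3 Every `p`-ramified witness of `(SeedII⁶)` is a regular twist partner -/

/-- **Every `p`-RAMIFIED witness of `(SeedII⁶)` is a regular twist partner** (converse of `seed_of_ramifiedTwist`). If an imaginary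
quadratic `K₀` with `d_{K₀}` odd and `p ∣ d_{K₀}` — so `d_{K₀} = −ps`, `s ≡ 1 (mod 4)` squarefree, `s ⊥ p` — has every prime of
`m` split and a UNIT field factor `¬ ‖k⁻¹ B_{k,(χ↑ε₀↑)~}‖ ≤ p⁻¹`, then `(s, χ' = χ·J(· | s))` satisfies every clause of (TwistReg⁶):
the real-twist partner class `e·s` lies in the `K₀`-split progression and is Eisenstein-REGULAR. With `seed_of_ramifiedTwist`: on the `p`-ramified side
registry v21's `stub_seedOff` and (TwistReg⁶) are the SAME statement; what (TwistReg⁶) gives up is only the `p`-inert and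
`p`-split seeds. [cite: Washington1997, Thm. 5.11 and Cor. 5.13] [cite: Cox2013, §1.C Lemma 1.14] [cite: Marcus2018, Ch. 3 Thm. 25] -/
theorem twistRegular_of_ramifiedSeed (hp3 : p % 4 = 3) (h7 : 7 ≤ p) {m : ℕ} [NeZero m] (hmp : m.Coprime p)
    (χ : DirichletCharacter ℚ_[p] m) (hχ : χ.IsPrimitive) {k : ℕ} (hk : k = (p + 1) / 4 ∨ k = (3 * p - 1) / 4)
    {K₀ : Type} [Field K₀] [NumberField K₀] (hK₀ : IsImaginaryQuadratic K₀)
    (hsplitK : ∀ q : ℕ, q.Prime → q ∣ m → ((Ideal.span {(q : ℤ)}).primesOver (𝓞 K₀)).ncard = 2)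
    (hodd : Odd (NumberField.discr K₀)) (hpd : (p : ℤ) ∣ NumberField.discr K₀)
    {ε₀ : DirichletCharacter ℚ_[p] (NumberField.discr K₀).natAbs} (hε₀ : IsKroneckerCharacterOf K₀ ε₀)
    (hunitK : ¬ ‖(k : ℚ_[p])⁻¹ * @generalizedBernoulli ℚ_[p] _ _
        (changeLevel (dvd_mul_right m (NumberField.discr K₀).natAbs) χ *
          changeLevel (dvd_mul_left (NumberField.discr K₀).natAbs m) ε₀).conductor ⟨conductor_ne_zero _⟩ k
        (changeLevel (dvd_mul_right m (NumberField.discr K₀).natAbs) χ *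
          changeLevel (dvd_mul_left (NumberField.discr K₀).natAbs m) ε₀).primitiveCharacter‖ ≤ (p : ℝ)⁻¹) :
    ∃ (s : ℕ) (_ : NeZero s) (χ' : DirichletCharacter ℚ_[p] (m * s)),
      s % 4 = 1 ∧ Squarefree s ∧ s.Coprime p ∧
      ((∀ q : ℕ, q.Prime → q ∣ m → q ≠ 2 → jacobiSym (-((p * s : ℕ) : ℤ)) q = 1) ∧ (2 ∣ m → (p * s) % 8 = 7)) ∧
      (∀ a : ℕ, χ' (a : ZMod (m * s)) = χ (a : ZMod m) * (J((a : ℤ) | s) : ℚ_[p])) ∧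
      ¬ ‖((p - k : ℕ) : ℚ_[p])⁻¹ * generalizedBernoulli (p - k) χ'‖ ≤ (p : ℝ)⁻¹ := by
  have hpp := hp.out
  have h2 := hK₀.1
  have hneg : NumberField.discr K₀ < 0 := IsImaginaryQuadratic.discr_neg hK₀
  -- `|d| = p·s`
  have hpn : p ∣ (NumberField.discr K₀).natAbs := Int.natCast_dvd.mp hpd
  obtain ⟨s, hs⟩ := hpn
  have hd : NumberField.discr K₀ = -((p * s : ℕ) : ℤ) := by
    rw [← hs, Int.ofNat_natAbs_of_nonpos hneg.le, neg_neg]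
  -- `d` is an odd fundamental discriminant: `ps ≡ 3 (mod 4)` squarefree
  have hfund : (p * s) % 4 = 3 ∧ Squarefree (p * s) := by
    rcases Quadratic.isFundamentalDiscriminant_discr (K := K₀) h2 with ⟨h1, hsf, -⟩ | ⟨h4, -, -⟩
    · refine ⟨?_, ?_⟩
      · rw [hd] at h1
        omega
      · rw [hd, ← Int.squarefree_natAbs, Int.natAbs_neg, Int.natAbs_natCast] at hsf
        exact hsf
    · exfalso
      rw [Int.odd_iff] at hodd
      omega
  obtain ⟨hps3, hpsq⟩ := hfund
  have hs0 : s ≠ 0 := by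
    rintro rfl
    simp at hps3
  haveI : NeZero s := ⟨hs0⟩
  obtain ⟨hsp', -, hsq⟩ := Nat.squarefree_mul_iff.mp hpsq
  have hsp : s.Coprime p := hsp'.symm
  have hs4 : s % 4 = 1 := by
    have hmod : (p * s) % 4 = (p % 4) * (s % 4) % 4 := Nat.mul_mod p s 4
    rw [hp3, hps3] at hmod
    omega
  -- `m ⊥ s`: a common prime would ramify in `K₀`
  have hms : m.Coprime s := by
    refine Nat.coprime_of_dvd fun q hq hqm hqs => ?_
    have hsplit := hsplitK q hq hqm
    by_cases hq2 : q = 2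
    · subst hq2
      omega
    · rw [Quadratic.ncard_primesOver_eq_two_iff_jacobiSym h2 hq hq2, hd] at hsplit
      have hdvd : (q : ℤ) ∣ -((p * s : ℕ) : ℤ) :=
        (Int.natCast_dvd_natCast.mpr (Dvd.dvd.mul_left hqs p)).neg_right
      rw [jacobiSym.mod_left, Int.emod_eq_zero_of_dvd hdvd, jacobiSym.zero_left hq.one_lt] at hsplit
      exact zero_ne_one hsplit
  obtain ⟨χ', hχ'⟩ := exists_twistChar χ s
  refine ⟨s, inferInstance, χ', hs4, hsq, hsp, ⟨fun q hq hqm hq2 => ?_, fun hm2 => ?_⟩, hχ', ?_⟩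
  · rw [← hd, ← Quadratic.ncard_primesOver_eq_two_iff_jacobiSym h2 hq hq2]
    exact hsplitK q hq hqm
  · have h8 := (Quadratic.ncard_primesOver_two_eq_two_iff h2).mp (by simpa using hsplitK 2 Nat.prime_two hm2)
    rw [hd] at h8
    omega
  · rwa [norm_fieldFactor_le_inv_iff_twistClassFactor hp3 h7 hmp χ hχ hk hs4 hsp hms hK₀ hd hε₀ χ' hχ'] at hunitK

/-! ## §4 The splitting clause as a progression condition on `s` -/

omit hp in
/-- **The `K₀`-split clause of (TwistReg⁶) is a progression condition**: for a prime `q ∤ ps`,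
`J(−ps | q) = 1 ⟺ J(s | q) = J(−p | q)` (multiplicativity in the numerator; both Legendre symbols are `±1`). So `s` is asked to lie
in the classes modulo each odd `q ∣ m` with `(s/q) = (−p/q)` — «the `ℚ(√−ps)`-split real-twist progression of the class».
[cite: IrelandRosen1990, Prop. 5.1.2] -/
theorem jacobiSym_neg_mul_eq_one_iff {q : ℕ} (hq : q.Prime) {s : ℕ} (hqp : ¬ q ∣ p) (hqs : ¬ q ∣ s) :
    jacobiSym (-((p * s : ℕ) : ℤ)) q = 1 ↔ jacobiSym (s : ℤ) q = jacobiSym (-(p : ℤ)) q := by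
  haveI := Fact.mk hq
  have e : (-((p * s : ℕ) : ℤ)) = (-(p : ℤ)) * (s : ℤ) := by push_cast; ring
  rw [e, jacobiSym.mul_left, ← jacobiSym.legendreSym.to_jacobiSym, ← jacobiSym.legendreSym.to_jacobiSym]
  have hp0 : ((-(p : ℤ) : ℤ) : ZMod q) ≠ 0 := by
    rw [Int.cast_neg, Int.cast_natCast, neg_ne_zero, Ne, ZMod.natCast_eq_zero_iff]
    exact hqp
  have hs0 : ((s : ℤ) : ZMod q) ≠ 0 := by
    rw [Int.cast_natCast, Ne, ZMod.natCast_eq_zero_iff]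
    exact hqs
  rcases legendreSym.eq_one_or_neg_one q hp0 with h1 | h1 <;>
    rcases legendreSym.eq_one_or_neg_one q hs0 with h2 | h2 <;>
    rw [h1, h2] <;> norm_num

end Summit.BirchSwinnertonDyer.BirchSwinnertonDyer.Theorems.PrintCFram.HeegnerFieldSupply

end
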